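import Summits.Ventures.Crystal3D.Theorems.StickyWulffConstantGenericWallFloorRayTerraceDiscWord
import HarnessLib

/-!
# The period disc, part 3: ray b of the same slot (first push normal `(−1,1,1)`) — the mirror image, rotating by `ρ⁻¹`
# (crux `GenericWallFloor`, stmt-Ventures-19480, line `WallLedgerG`; completes `chainFrames (e₃) A (slotSite 8)` on `D₁`)

HONEST FRAMING. Venture `Summits/Ventures/Crystal3D` (cell `crystal3d-full`), helper `--supports` the crux
`GenericWallFloor` (stmt-Ventures-19480) of `route-Ventures-StickyWulffConstant`, REGISTERED line `WallLedgerG`, open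
stub `stub_twoSlabAdhesion`.  Rung credit only; F-C1 not moved; NOT the stub; census-free, standard axioms.

`chainFrames z A u` (the frames a stack walker of the grain `(A, u)` can carry) consists of `A` and the frames of the TWO
forced rays from `u`, one per admissible first push normal; for `u = slotSite 8` these have cubic numerators `(1,1,1)` (the
terrace, ray a: `…RayTerraceDisc`, `…RayTerraceDiscWord`) and `(−1,1,1)` (ray b, `first_normal_cubic`).  This file is ray b on
the SAME open period cone about `e = (0,1,2)`: it is the image of ray a under the cubic mirror `x₀ ↦ −x₀` (which fixes `e` and
`u`), so the SECOND rising member wins, one push is `ρ⁻¹ = rotE (−2/3) (1/3)`, and the parameters are `(discCS k).1, −(discCS k).2`.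

* `terraceDiscB_push`, **`terraceDiscB_levels`** — level `k` of `forcedTop z ⟨A, slotSite 8, 0⟩ n' k` (`κ(n') = (−1,1,1)/√3`) has
  numerators `rotE (c_{k+1}) (−s_{k+1}) (0,1,1)` and `rotE (c_{k+1}) (−s_{k+1}) (−1,1,1)`.
* `reflD`, `discQB := reflD ∘ ρ` (order four), `discWB k` (period four, explicit `discWB_zero … _three`),
  **`terraceDiscB_frames`**: `κ((forcedTop … k).frame x) = rotE (c_k) (−s_k) (discWB k (cubicCoords x))`;
  `terraceDiscB_frame_mem_family`.
* **`chainFrames_slotSite_eight_subset`** — THE ORBIT-FAMILY LEMMA for the in-disc slot: every `F ∈ chainFrames z A (slotSite 8)`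
  is `A`, or `A ∘ rotE c s ∘ W_r` (ray a), or `A ∘ rotE c s ∘ W'_r` (ray b), with `c² + 5s² = 1`, `r < 4` — the compact
  `{id} ⊔ (S¹ × 4) ⊔ (S¹ × 4)` family of cf-p1 (lxviii) («deepArrival_mem_orbitFamily», frame form), for every steering in the cone.
WHAT THIS IS NOT: no statement about packings or cells; rays from the other steep slots `(±1,0,1)` are not treated (their rays
through `(±1,1,1)` join these at level `0`; the ray through `(1,−1,1)` is NOT uniform on `D₁`); not the stub; F-C1 not moved.
-/

noncomputable section

namespace Summit.Ventures.Crystal3D.Theorems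

open Summit.Ventures.Crystal3D Finset Matrix
open scoped InnerProductSpace

/-! ### One push of ray b -/

/-- Numeric facts for ray b: heights and squared lengths of the margin vectors `(0,1,1) − (−1,1,0)` and `(−1,0,1) − (−1,1,0)`. -/
theorem terraceDiscB_base_facts :
    ((![0, 1, 1] : Fin 3 → ℝ) - ![-1, 1, 0]) ⬝ᵥ (![0, 1, 2] : Fin 3 → ℝ) = 2 ∧
    ((![0, 1, 1] : Fin 3 → ℝ) - ![-1, 1, 0]) ⬝ᵥ ((![0, 1, 1] : Fin 3 → ℝ) - ![-1, 1, 0]) = 2 ∧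
    ((![-1, 0, 1] : Fin 3 → ℝ) - ![-1, 1, 0]) ⬝ᵥ (![0, 1, 2] : Fin 3 → ℝ) = 1 ∧
    ((![-1, 0, 1] : Fin 3 → ℝ) - ![-1, 1, 0]) ⬝ᵥ ((![-1, 0, 1] : Fin 3 → ℝ) - ![-1, 1, 0]) = 2 := by
  refine ⟨?_, ?_, ?_, ?_⟩ <;> norm_num [dotProduct, Fin.sum_univ_three, Matrix.cons_val_zero, Matrix.cons_val_one,
    Matrix.cons_val_two, Matrix.head_cons, Matrix.tail_cons]

/-- **Cone selection, ray b**: `rotE c s (−1,1,0)` is strictly `Zc`-below `rotE c s (0,1,1)` and `rotE c s (−1,0,1)`. -/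
theorem terraceDiscB_select {c s : ℝ} (h : c ^ 2 + 5 * s ^ 2 = 1) {Zc : Fin 3 → ℝ}
    (hZe : 0 < Zc ⬝ᵥ (![0, 1, 2] : Fin 3 → ℝ)) (hZ : 9 * (Zc ⬝ᵥ Zc) < 2 * (Zc ⬝ᵥ (![0, 1, 2] : Fin 3 → ℝ)) ^ 2) :
    Zc ⬝ᵥ rotE c s ![-1, 1, 0] < Zc ⬝ᵥ rotE c s ![0, 1, 1] ∧
      Zc ⬝ᵥ rotE c s ![-1, 1, 0] < Zc ⬝ᵥ rotE c s ![-1, 0, 1] := by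
  obtain ⟨f1, f2, f3, f4⟩ := terraceDiscB_base_facts
  constructor
  · have hv := cone_pos (v := rotE c s (![0, 1, 1] - ![-1, 1, 0])) hZe hZ
      (by rw [rotE_dotProduct_e, f1]; norm_num) (by rw [rotE_dotProduct h, rotE_dotProduct_e, f1, f2]; norm_num)
    rw [rotE_sub, dotProduct_sub] at hv
    linarith
  · have hv := cone_pos (v := rotE c s (![-1, 0, 1] - ![-1, 1, 0])) hZe hZ
      (by rw [rotE_dotProduct_e, f3]; norm_num) (by rw [rotE_dotProduct h, rotE_dotProduct_e, f3, f4]; norm_num)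
    rw [rotE_sub, dotProduct_sub] at hv
    linarith

/-- **One push of ray b is `ρ⁻¹`.**  With `X = rotE c s (0,1,1)`, `P = rotE c s (−1,1,1)` on the ellipse and `Zc` in the cone:
the selection hypotheses of `ray_push_cubic` hold for the SECOND member `Xj = rotE c s (−1,1,0)`, and the updated numerators are
`rotE c' s' (0,1,1)`, `rotE c' s' (−1,1,1)` with `(c', s') = (−2c/3 − 5s/3, c/3 − 2s/3)` (= `rotE c s ∘ ρ⁻¹`). -/
theorem terraceDiscB_push {c s : ℝ} (h : c ^ 2 + 5 * s ^ 2 = 1) {Zc : Fin 3 → ℝ}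
    (hZe : 0 < Zc ⬝ᵥ (![0, 1, 2] : Fin 3 → ℝ)) (hZ : 9 * (Zc ⬝ᵥ Zc) < 2 * (Zc ⬝ᵥ (![0, 1, 2] : Fin 3 → ℝ)) ^ 2) :
    (rotE c s ![-1, 1, 0] = rotE c s ![0, 1, 1] ∨
      rotE c s ![-1, 1, 0] = (1 / 2 : ℝ) • (-rotE c s ![0, 1, 1] + rotE c s ![-1, 1, 1] ⨯₃ rotE c s ![0, 1, 1] +
        (2 : ℝ) • rotE c s ![-1, 1, 1]) ∨
      rotE c s ![-1, 1, 0] = (1 / 2 : ℝ) • (-rotE c s ![0, 1, 1] - rotE c s ![-1, 1, 1] ⨯₃ rotE c s ![0, 1, 1] +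
        (2 : ℝ) • rotE c s ![-1, 1, 1])) ∧
    (∀ Y : Fin 3 → ℝ, (Y = rotE c s ![0, 1, 1] ∨
        Y = (1 / 2 : ℝ) • (-rotE c s ![0, 1, 1] + rotE c s ![-1, 1, 1] ⨯₃ rotE c s ![0, 1, 1] +
          (2 : ℝ) • rotE c s ![-1, 1, 1]) ∨
        Y = (1 / 2 : ℝ) • (-rotE c s ![0, 1, 1] - rotE c s ![-1, 1, 1] ⨯₃ rotE c s ![0, 1, 1] +
          (2 : ℝ) • rotE c s ![-1, 1, 1])) →
      Y ≠ rotE c s ![-1, 1, 0] → Zc ⬝ᵥ rotE c s ![-1, 1, 0] < Zc ⬝ᵥ Y) ∧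
    (4 / 3 : ℝ) • rotE c s ![-1, 1, 1] - rotE c s ![-1, 1, 0] =
      rotE (-2 / 3 * c - 5 / 3 * s) (1 / 3 * c - 2 / 3 * s) ![0, 1, 1] ∧
    (5 / 3 : ℝ) • rotE c s ![-1, 1, 1] - (2 : ℝ) • rotE c s ![-1, 1, 0] =
      rotE (-2 / 3 * c - 5 / 3 * s) (1 / 3 * c - 2 / 3 * s) ![-1, 1, 1] := by
  obtain ⟨hs₁, hs₃⟩ := terraceDiscB_select h hZe hZ
  have h₂ : (1 / 2 : ℝ) • (-rotE c s ![0, 1, 1] + rotE c s ![-1, 1, 1] ⨯₃ rotE c s ![0, 1, 1] +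
      (2 : ℝ) • rotE c s ![-1, 1, 1]) = rotE c s ![-1, 1, 0] := by
    ext i; fin_cases i <;> simp [cross_apply, Matrix.vecHead, Matrix.vecTail]
    · ring
    · linear_combination (-1 / 10 : ℝ) * h
    · linear_combination (-1 / 5 : ℝ) * h
  have h₃ : (1 / 2 : ℝ) • (-rotE c s ![0, 1, 1] - rotE c s ![-1, 1, 1] ⨯₃ rotE c s ![0, 1, 1] +
      (2 : ℝ) • rotE c s ![-1, 1, 1]) = rotE c s ![-1, 0, 1] := by
    ext i; fin_cases i <;> simp [cross_apply, Matrix.vecHead, Matrix.vecTail]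
    · ring
    · linear_combination (1 / 10 : ℝ) * h
    · linear_combination (1 / 5 : ℝ) * h
  obtain ⟨hj, hlt⟩ := triple_selection (Zc := Zc) h₂ h₃ (Or.inr (Or.inl rfl)) (fun _ => hs₁) (fun hne => (hne rfl).elim)
    (fun _ => hs₃)
  refine ⟨hj, hlt, ?_, ?_⟩
  · ext i; fin_cases i <;> simp <;> ring
  · ext i; fin_cases i <;> simp <;> ring

/-- `rotE (c_{k+1}) (−s_{k+1}) = rotE (c_k) (−s_k) ∘ ρ⁻¹`: the mirrored parameters are those of the powers of `ρ⁻¹`. -/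
theorem rotE_discCS_neg_succ (k : ℕ) (v : Fin 3 → ℝ) :
    rotE (discCS (k + 1)).1 (-(discCS (k + 1)).2) v = rotE (discCS k).1 (-(discCS k).2) (rotE (-2 / 3) (1 / 3) v) := by
  rw [rotE_rotE, discCS_succ]
  congr 1 <;> ring

/-- The ray-b update lands on the next mirrored parameters: `(−2c/3 − 5s/3, c/3 − 2s/3)` at `(c, s) = (c_k, −s_k)` is
`(c_{k+1}, −s_{k+1})`. -/
theorem rotE_discCS_neg_step (k : ℕ) (v : Fin 3 → ℝ) :
    rotE (-2 / 3 * (discCS k).1 - 5 / 3 * -(discCS k).2) (1 / 3 * (discCS k).1 - 2 / 3 * -(discCS k).2) v =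
      rotE (discCS (k + 1)).1 (-(discCS (k + 1)).2) v := by
  rw [discCS_succ]
  congr 1 <;> ring

/-- `rotE (c_k) (−s_k) = rotE (c_{k+1}) (−s_{k+1}) ∘ ρ`. -/
theorem rotE_discCS_neg_prev (k : ℕ) (y : Fin 3 → ℝ) :
    rotE (discCS k).1 (-(discCS k).2) y = rotE (discCS (k + 1)).1 (-(discCS (k + 1)).2) (rotE (-2 / 3) (-1 / 3) y) := by
  rw [rotE_rotE, discCS_succ]
  congr 1 <;> ring

/-- The mirrored parameters stay on the ellipse. -/
theorem discCS_neg_ellipse (k : ℕ) : (discCS k).1 ^ 2 + 5 * (-(discCS k).2) ^ 2 = 1 := by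
  rw [neg_sq]; exact discCS_ellipse k

section RayB

variable (A : EuclideanSpace ℝ (Fin 3) ≃ₗᵢ[ℝ] EuclideanSpace ℝ (Fin 3)) {n z : EuclideanSpace ℝ (Fin 3)}
  {Zc : Fin 3 → ℝ} {t : ℝ}

/-- **Ray b on the disc, all levels.**  First push normal `n'` with `κ(n') = (−1,1,1)/√3` (positive on `slotSite 8`), steering in the
open period cone: level `k` has direction numerator `rotE (c_{k+1}) (−s_{k+1}) (0,1,1)` and next push normal numerator
`rotE (c_{k+1}) (−s_{k+1}) (−1,1,1)`, `(c_j, s_j) = discCS j`. -/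
theorem terraceDiscB_levels (hn : ‖n‖ = 1)
    (hmenu : ∀ w ∈ fccSlots, ⟪A w, n⟫_ℝ = 0 ∨ ⟪A w, n⟫_ℝ = Real.sqrt (2 / 3) ∨ ⟪A w, n⟫_ℝ = -Real.sqrt (2 / 3))
    (hpos : ⟪A (slotSite 8), n⟫_ℝ = Real.sqrt (2 / 3))
    (hPn : cubicCoords (A.symm n) = (Real.sqrt 3)⁻¹ • (![(-1 : ℝ), 1, 1] : Fin 3 → ℝ))
    (hZ : cubicCoords (A.symm z) = t • Zc) (ht : 0 < t)
    (hZe : 0 < Zc ⬝ᵥ (![0, 1, 2] : Fin 3 → ℝ)) (hZc : 9 * (Zc ⬝ᵥ Zc) < 2 * (Zc ⬝ᵥ (![0, 1, 2] : Fin 3 → ℝ)) ^ 2) :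
    ∀ k : ℕ,
      cubicCoords (A.symm ((forcedTop z ⟨A, slotSite 8, 0⟩ n k).frame (forcedTop z ⟨A, slotSite 8, 0⟩ n k).dir)) =
          (Real.sqrt 2)⁻¹ • rotE (discCS (k + 1)).1 (-(discCS (k + 1)).2) ![0, 1, 1] ∧
        cubicCoords (A.symm (nextNormal (forcedTop z ⟨A, slotSite 8, 0⟩ n k))) =
          (Real.sqrt 3)⁻¹ • rotE (discCS (k + 1)).1 (-(discCS (k + 1)).2) ![-1, 1, 1]
  | 0 => by
    obtain ⟨hj, hlt, u1, u2⟩ := terraceDiscB_push (discCS_neg_ellipse 0) hZe hZc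
    have hX : cubicCoords (slotSite 8) = (Real.sqrt 2)⁻¹ • rotE (discCS 0).1 (-(discCS 0).2) ![0, 1, 1] := by
      rw [cubicCoords_slotSite_eight, discCS_zero, neg_zero, rotE_one_zero]
    have hP : cubicCoords (A.symm n) = (Real.sqrt 3)⁻¹ • rotE (discCS 0).1 (-(discCS 0).2) ![-1, 1, 1] := by
      rw [hPn, discCS_zero, neg_zero, rotE_one_zero]
    obtain ⟨h1, h2⟩ := forcedTop_zero_cubic A (slotSite_mem 8) hn hmenu hpos hZ ht hX hP hj hlt
    rw [u1, rotE_discCS_neg_step] at h1; rw [u2, rotE_discCS_neg_step] at h2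
    exact ⟨h1, h2⟩
  | k + 1 => by
    obtain ⟨hX, hP⟩ := terraceDiscB_levels hn hmenu hpos hPn hZ ht hZe hZc k
    obtain ⟨hj, hlt, u1, u2⟩ := terraceDiscB_push (discCS_neg_ellipse (k + 1)) hZe hZc
    obtain ⟨h1, h2⟩ := forcedTop_succ_cubic A hn hmenu hZ ht k hX hP hj hlt
    rw [u1, rotE_discCS_neg_step] at h1; rw [u2, rotE_discCS_neg_step] at h2
    exact ⟨h1, h2⟩

end RayB

/-- Ray b: every direction has `X·e = 3` and rises in every cone steering. -/
theorem terraceDiscB_dir_pos {Zc : Fin 3 → ℝ} (hZe : 0 < Zc ⬝ᵥ (![0, 1, 2] : Fin 3 → ℝ))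
    (hZc : 9 * (Zc ⬝ᵥ Zc) < 2 * (Zc ⬝ᵥ (![0, 1, 2] : Fin 3 → ℝ)) ^ 2) (k : ℕ) :
    rotE (discCS k).1 (-(discCS k).2) ![0, 1, 1] ⬝ᵥ (![0, 1, 2] : Fin 3 → ℝ) = 3 ∧
      0 < Zc ⬝ᵥ rotE (discCS k).1 (-(discCS k).2) ![0, 1, 1] := by
  have he : rotE (discCS k).1 (-(discCS k).2) ![0, 1, 1] ⬝ᵥ (![0, 1, 2] : Fin 3 → ℝ) = 3 := by
    rw [rotE_dotProduct_e]
    norm_num [dotProduct, Fin.sum_univ_three, Matrix.cons_val_zero, Matrix.cons_val_one, Matrix.cons_val_two,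
      Matrix.head_cons, Matrix.tail_cons]
  refine ⟨he, cone_pos hZe hZc (by rw [he]; norm_num) ?_⟩
  rw [rotE_dotProduct (discCS_neg_ellipse k), he]
  norm_num [dotProduct, Fin.sum_univ_three, Matrix.cons_val_zero, Matrix.cons_val_one, Matrix.cons_val_two,
    Matrix.head_cons, Matrix.tail_cons]

/-! ### Frames of ray b -/

/-- The cubic reflection in the ray-b numerator `b' = (−1,1,1)`. -/
def reflD (w : Fin 3 → ℝ) : Fin 3 → ℝ :=
  w - (2 / 3 * (w ⬝ᵥ (![-1, 1, 1] : Fin 3 → ℝ))) • (![-1, 1, 1] : Fin 3 → ℝ)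

/-- `reflD` in coordinates. -/
theorem reflD_eq (w : Fin 3 → ℝ) :
    reflD w = ![(w 0 + 2 * w 1 + 2 * w 2) / 3, (2 * w 0 + w 1 - 2 * w 2) / 3, (2 * w 0 - 2 * w 1 + w 2) / 3] := by
  ext i; fin_cases i <;>
    simp [reflD, dotProduct, Fin.sum_univ_three, Matrix.cons_val_zero, Matrix.cons_val_one, Matrix.cons_val_two,
      Matrix.head_cons, Matrix.tail_cons] <;> ring

/-- The ROTOREFLECTION of ray b, `Q' := reflD ∘ ρ` (`ρ = rotE (−2/3) (−1/3)`). -/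
def discQB (w : Fin 3 → ℝ) : Fin 3 → ℝ :=
  reflD (rotE (-2 / 3) (-1 / 3) w)

/-- `Q'` in coordinates: `[[−4,4,7],[−8,−1,−4],[1,8,−4]]/9`. -/
theorem discQB_eq (w : Fin 3 → ℝ) :
    discQB w = ![(-4 * w 0 + 4 * w 1 + 7 * w 2) / 9, (-8 * w 0 - w 1 - 4 * w 2) / 9, (w 0 + 8 * w 1 - 4 * w 2) / 9] := by
  rw [discQB, reflD_eq]
  ext i; fin_cases i <;> simp <;> ring

/-- **`Q'` has order four.** -/
theorem discQB_four (w : Fin 3 → ℝ) : discQB (discQB (discQB (discQB w))) = w := by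
  rw [discQB_eq, discQB_eq, discQB_eq, discQB_eq]
  ext i; fin_cases i <;> simp <;> ring

/-- The frame matrices of ray b, `W'_k := Q'ᵏ ∘ reflD`. -/
def discWB : ℕ → (Fin 3 → ℝ) → (Fin 3 → ℝ)
  | 0 => reflD
  | k + 1 => fun w => discQB (discWB k w)

/-- Unfolding `discWB 0`. -/
theorem discWB_zero_apply (w : Fin 3 → ℝ) : discWB 0 w = reflD w := rfl

/-- Unfolding `discWB (k + 1)`. -/
theorem discWB_succ_apply (k : ℕ) (w : Fin 3 → ℝ) : discWB (k + 1) w = discQB (discWB k w) := rfl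

/-- **Period four**: `W'_{k+4} = W'_k`. -/
theorem discWB_add_four (k : ℕ) (w : Fin 3 → ℝ) : discWB (k + 4) w = discWB k w := by
  rw [show k + 4 = k + 1 + 1 + 1 + 1 from rfl, discWB_succ_apply, discWB_succ_apply, discWB_succ_apply, discWB_succ_apply,
    discQB_four]

/-- `W'_0 = [[1,2,2],[2,1,−2],[2,−2,1]]/3`. -/
theorem discWB_zero (w : Fin 3 → ℝ) :
    discWB 0 w = ![(w 0 + 2 * w 1 + 2 * w 2) / 3, (2 * w 0 + w 1 - 2 * w 2) / 3, (2 * w 0 - 2 * w 1 + w 2) / 3] := by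
  rw [discWB_zero_apply, reflD_eq]

/-- `W'_1 = [[2,−2,−1],[−2,−1,−2],[1,2,−2]]/3`. -/
theorem discWB_one (w : Fin 3 → ℝ) :
    discWB 1 w = ![(2 * w 0 - 2 * w 1 - w 2) / 3, (-2 * w 0 - w 1 - 2 * w 2) / 3, (w 0 + 2 * w 1 - 2 * w 2) / 3] := by
  rw [discWB_succ_apply, discWB_zero, discQB_eq]
  ext i; fin_cases i <;> simp <;> ring

/-- `W'_2 = [[−1,2,−2],[−2,1,2],[−2,−2,−1]]/3`. -/
theorem discWB_two (w : Fin 3 → ℝ) :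
    discWB 2 w = ![(-w 0 + 2 * w 1 - 2 * w 2) / 3, (-2 * w 0 + w 1 + 2 * w 2) / 3, (-2 * w 0 - 2 * w 1 - w 2) / 3] := by
  rw [discWB_succ_apply, discWB_one, discQB_eq]
  ext i; fin_cases i <;> simp <;> ring

/-- `W'_3 = [[−2,−2,1],[2,−1,2],[−1,2,2]]/3` (`= ρ⁻¹`). -/
theorem discWB_three (w : Fin 3 → ℝ) :
    discWB 3 w = ![(-2 * w 0 - 2 * w 1 + w 2) / 3, (2 * w 0 - w 1 + 2 * w 2) / 3, (-w 0 + 2 * w 1 + 2 * w 2) / 3] := by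
  rw [discWB_succ_apply, discWB_two, discQB_eq]
  ext i; fin_cases i <;> simp <;> ring

/-- `rotE` intertwines `reflD` with the reflection in the current push normal of ray b (on the ellipse). -/
theorem rotE_reflD {c s : ℝ} (h : c ^ 2 + 5 * s ^ 2 = 1) (y : Fin 3 → ℝ) :
    rotE c s y - (2 / 3 * (rotE c s y ⬝ᵥ rotE c s ![-1, 1, 1])) • rotE c s ![-1, 1, 1] = rotE c s (reflD y) := by
  rw [rotE_dotProduct h, reflD, rotE_sub, rotE_smul]

section RayBFrames

variable (A : EuclideanSpace ℝ (Fin 3) ≃ₗᵢ[ℝ] EuclideanSpace ℝ (Fin 3)) {n z : EuclideanSpace ℝ (Fin 3)}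
  {Zc : Fin 3 → ℝ} {t : ℝ}

/-- **The frames of ray b.**  `κ((forcedTop z ⟨A, slotSite 8, 0⟩ n' k).frame x) = rotE (c_k) (−s_k) (W'_k (cubicCoords x))`. -/
theorem terraceDiscB_frames (hn : ‖n‖ = 1)
    (hmenu : ∀ w ∈ fccSlots, ⟪A w, n⟫_ℝ = 0 ∨ ⟪A w, n⟫_ℝ = Real.sqrt (2 / 3) ∨ ⟪A w, n⟫_ℝ = -Real.sqrt (2 / 3))
    (hpos : ⟪A (slotSite 8), n⟫_ℝ = Real.sqrt (2 / 3))
    (hPn : cubicCoords (A.symm n) = (Real.sqrt 3)⁻¹ • (![(-1 : ℝ), 1, 1] : Fin 3 → ℝ))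
    (hZ : cubicCoords (A.symm z) = t • Zc) (ht : 0 < t)
    (hZe : 0 < Zc ⬝ᵥ (![0, 1, 2] : Fin 3 → ℝ)) (hZc : 9 * (Zc ⬝ᵥ Zc) < 2 * (Zc ⬝ᵥ (![0, 1, 2] : Fin 3 → ℝ)) ^ 2) :
    ∀ (k : ℕ) (x : EuclideanSpace ℝ (Fin 3)),
      cubicCoords (A.symm ((forcedTop z ⟨A, slotSite 8, 0⟩ n k).frame x)) =
        rotE (discCS k).1 (-(discCS k).2) (discWB k (cubicCoords x))
  | 0, x => by
    obtain ⟨-, hs3, -, -, -⟩ := sqrt_two_three_facts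
    have hfr : (forcedTop z ⟨A, slotSite 8, 0⟩ n 0).frame = twinFrame A n := rfl
    rw [hfr, twinFrame_apply A hn, map_sub, cubicCoords_sub, LinearIsometryEquiv.map_smul, cubicCoords_smul,
      A.symm_apply_apply, inner_eq_cubic_symm A (A x) n, A.symm_apply_apply, hPn, dotProduct_smul, smul_smul,
      discCS_zero, neg_zero, rotE_one_zero, discWB_zero_apply, reflD]
    have h3inv : (Real.sqrt 3)⁻¹ * (Real.sqrt 3)⁻¹ = 1 / 3 := by rw [← mul_inv, hs3]; norm_num
    have e : 2 * ((Real.sqrt 3)⁻¹ • (cubicCoords x ⬝ᵥ ![-1, 1, 1])) * (Real.sqrt 3)⁻¹ =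
        2 / 3 * (cubicCoords x ⬝ᵥ ![-1, 1, 1]) := by
      rw [smul_eq_mul, show (2 : ℝ) * ((Real.sqrt 3)⁻¹ * (cubicCoords x ⬝ᵥ ![-1, 1, 1])) * (Real.sqrt 3)⁻¹ =
        2 * (cubicCoords x ⬝ᵥ ![-1, 1, 1]) * ((Real.sqrt 3)⁻¹ * (Real.sqrt 3)⁻¹) by ring, h3inv]
      ring
    rw [e]
  | k + 1, x => by
    have ih := terraceDiscB_frames hn hmenu hpos hPn hZ ht hZe hZc k
    obtain ⟨-, hs3, -, -, -⟩ := sqrt_two_three_facts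
    obtain ⟨-, hP⟩ := terraceDiscB_levels A hn hmenu hpos hPn hZ ht hZe hZc k
    have hN1 : ‖nextNormal (forcedTop z ⟨A, slotSite 8, 0⟩ n k)‖ = 1 :=
      (forcedTop_chain_invariant z A (slotSite 8) hn hmenu (k + 1)).1
    have hfr : (forcedTop z ⟨A, slotSite 8, 0⟩ n (k + 1)).frame =
        twinFrame (forcedTop z ⟨A, slotSite 8, 0⟩ n k).frame (nextNormal (forcedTop z ⟨A, slotSite 8, 0⟩ n k)) := rfl
    rw [hfr, twinFrame_apply _ hN1, map_sub, cubicCoords_sub, LinearIsometryEquiv.map_smul, cubicCoords_smul,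
      inner_eq_cubic_symm A, ih x, hP, dotProduct_smul, smul_smul, rotE_discCS_neg_prev k]
    set y := rotE (-2 / 3) (-1 / 3) (discWB k (cubicCoords x)) with hy
    have h3inv : (Real.sqrt 3)⁻¹ * (Real.sqrt 3)⁻¹ = 1 / 3 := by rw [← mul_inv, hs3]; norm_num
    set D := rotE (discCS (k + 1)).1 (-(discCS (k + 1)).2) y ⬝ᵥ rotE (discCS (k + 1)).1 (-(discCS (k + 1)).2) ![-1, 1, 1]
      with hD
    have e : 2 * ((Real.sqrt 3)⁻¹ • D) * (Real.sqrt 3)⁻¹ = 2 / 3 * D := by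
      rw [smul_eq_mul, show (2 : ℝ) * ((Real.sqrt 3)⁻¹ * D) * (Real.sqrt 3)⁻¹ =
        2 * D * ((Real.sqrt 3)⁻¹ * (Real.sqrt 3)⁻¹) by ring, h3inv]
      ring
    rw [e, hD, rotE_reflD (discCS_neg_ellipse (k + 1)), discWB_succ_apply, discQB, hy]

/-- **The compact frame family of ray b**: every level frame is `A ∘ rotE c s ∘ W'_r`, `c² + 5s² = 1`, `r < 4`. -/
theorem terraceDiscB_frame_mem_family (hn : ‖n‖ = 1)
    (hmenu : ∀ w ∈ fccSlots, ⟪A w, n⟫_ℝ = 0 ∨ ⟪A w, n⟫_ℝ = Real.sqrt (2 / 3) ∨ ⟪A w, n⟫_ℝ = -Real.sqrt (2 / 3))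
    (hpos : ⟪A (slotSite 8), n⟫_ℝ = Real.sqrt (2 / 3))
    (hPn : cubicCoords (A.symm n) = (Real.sqrt 3)⁻¹ • (![(-1 : ℝ), 1, 1] : Fin 3 → ℝ))
    (hZ : cubicCoords (A.symm z) = t • Zc) (ht : 0 < t)
    (hZe : 0 < Zc ⬝ᵥ (![0, 1, 2] : Fin 3 → ℝ)) (hZc : 9 * (Zc ⬝ᵥ Zc) < 2 * (Zc ⬝ᵥ (![0, 1, 2] : Fin 3 → ℝ)) ^ 2)
    (k : ℕ) :
    ∃ c s : ℝ, c ^ 2 + 5 * s ^ 2 = 1 ∧ ∃ r < 4, ∀ x : EuclideanSpace ℝ (Fin 3),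
      cubicCoords (A.symm ((forcedTop z ⟨A, slotSite 8, 0⟩ n k).frame x)) = rotE c s (discWB r (cubicCoords x)) := by
  refine ⟨(discCS k).1, -(discCS k).2, discCS_neg_ellipse k, k % 4, Nat.mod_lt k (by norm_num), fun x => ?_⟩
  rw [terraceDiscB_frames A hn hmenu hpos hPn hZ ht hZe hZc k x]
  congr 1
  conv_lhs => rw [← Nat.div_add_mod k 4]
  generalize k / 4 = q
  induction q with
  | zero => rw [Nat.mul_zero, Nat.zero_add]
  | succ q ih => rw [show 4 * (q + 1) + k % 4 = 4 * q + k % 4 + 4 by ring, discWB_add_four, ih]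

end RayBFrames

/-! ### The orbit-family lemma for the in-disc slot -/

/-- **`chainFrames` of the in-disc slot lie in the compact family** («deepArrival_mem_orbitFamily», frame form; cf-p1 (lxviii)).
For a steering `z` whose cubic direction lies in the open period cone about `(0,1,2)`, every frame a stack walker of the grain
`(A, slotSite 8)` can carry — every `F ∈ chainFrames z A (slotSite 8)` — is the base frame `A`, or `A ∘ rotE c s ∘ W_r` (ray a,
the terrace), or `A ∘ rotE c s ∘ W'_r` (ray b), in cubic coordinates, with `c² + 5s² = 1` and `r < 4`. -/
theorem chainFrames_slotSite_eight_subset (A : EuclideanSpace ℝ (Fin 3) ≃ₗᵢ[ℝ] EuclideanSpace ℝ (Fin 3))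
    {z : EuclideanSpace ℝ (Fin 3)} {Zc : Fin 3 → ℝ} {t : ℝ} (hZ : cubicCoords (A.symm z) = t • Zc) (ht : 0 < t)
    (hZe : 0 < Zc ⬝ᵥ (![0, 1, 2] : Fin 3 → ℝ)) (hZc : 9 * (Zc ⬝ᵥ Zc) < 2 * (Zc ⬝ᵥ (![0, 1, 2] : Fin 3 → ℝ)) ^ 2)
    {F : EuclideanSpace ℝ (Fin 3) ≃ₗᵢ[ℝ] EuclideanSpace ℝ (Fin 3)} (hF : F ∈ chainFrames z A (slotSite 8)) :
    F = A ∨ ∃ c s : ℝ, c ^ 2 + 5 * s ^ 2 = 1 ∧ ∃ r < 4,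
      (∀ x, cubicCoords (A.symm (F x)) = rotE c s (discW r (cubicCoords x))) ∨
      (∀ x, cubicCoords (A.symm (F x)) = rotE c s (discWB r (cubicCoords x))) := by
  rcases hF with rfl | ⟨n, hn, hmenu, hpos, k, rfl⟩
  · exact Or.inl rfl
  · right
    rcases first_normal_cubic A hn hmenu hpos with hPn | hPn
    · obtain ⟨c, s, h, r, hr, hx⟩ := terraceDisc_frame_mem_family A hn hmenu hpos hPn hZ ht hZe hZc k
      exact ⟨c, s, h, r, hr, Or.inl hx⟩
    · obtain ⟨c, s, h, r, hr, hx⟩ := terraceDiscB_frame_mem_family A hn hmenu hpos hPn hZ ht hZe hZc k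
      exact ⟨c, s, h, r, hr, Or.inr hx⟩

/-- **Untilted form** (the wall normal itself in the disc): for `z = e₃` and `ν := cubicCoords (A.symm e₃)` with
`0 < ν·(0,1,2)` and `9 ν·ν < 2 (ν·(0,1,2))²` (i.e. `⟪ν, (0,1,2)/√5⟫ > 3/√10`, 19480-p1's disc `D₁`), the same conclusion. -/
theorem chainFrames_slotSite_eight_subset_e₃ (A : EuclideanSpace ℝ (Fin 3) ≃ₗᵢ[ℝ] EuclideanSpace ℝ (Fin 3))
    (hνe : 0 < cubicCoords (A.symm (EuclideanSpace.single (2 : Fin 3) (1 : ℝ))) ⬝ᵥ (![0, 1, 2] : Fin 3 → ℝ))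
    (hν : 9 * (cubicCoords (A.symm (EuclideanSpace.single (2 : Fin 3) (1 : ℝ))) ⬝ᵥ
        cubicCoords (A.symm (EuclideanSpace.single (2 : Fin 3) (1 : ℝ)))) <
      2 * (cubicCoords (A.symm (EuclideanSpace.single (2 : Fin 3) (1 : ℝ))) ⬝ᵥ (![0, 1, 2] : Fin 3 → ℝ)) ^ 2)
    {F : EuclideanSpace ℝ (Fin 3) ≃ₗᵢ[ℝ] EuclideanSpace ℝ (Fin 3)}
    (hF : F ∈ chainFrames (EuclideanSpace.single (2 : Fin 3) (1 : ℝ)) A (slotSite 8)) :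
    F = A ∨ ∃ c s : ℝ, c ^ 2 + 5 * s ^ 2 = 1 ∧ ∃ r < 4,
      (∀ x, cubicCoords (A.symm (F x)) = rotE c s (discW r (cubicCoords x))) ∨
      (∀ x, cubicCoords (A.symm (F x)) = rotE c s (discWB r (cubicCoords x))) :=
  chainFrames_slotSite_eight_subset A (t := 1) (by rw [one_smul]) one_pos hνe hν hF

end Summit.Ventures.Crystal3D.Theorems

end
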